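import Literature.NumberTheory.Sieve.HeathBrownCubicFLRemaindersA
import Mathlib.NumberTheory.ArithmeticFunction.Moebius
import HarnessLib

/-!
# Heath-Brown 2001 (PLMS), Lemma 11, (7.3): `T(R) = ∑_d μ(d) S(R/(R,d); A/d, B/d, M/d)` in root language

Topic `Literature/NumberTheory/Sieve`; a PROVED combinatorial layer (one definition with body, no named
facts) under the named fact `Irving2015_largestPrimeFactor_cubic` (`LargestPrimeFactorCubic.lean`), first
step of Heath-Brown's **Lemma 11** (main-term programme, Lemma 7).  Source: D. R. Heath-Brown, *The
largest prime factor of `X³ + 2`*, Proc. London Math. Soc. (3) 82 (2001) 554–596, §7 p. 25: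
`T(R) = #{a, b : A < a ≤ A+M, B < b ≤ B+M, (a,b) = 1, R ∣ a − b∛2}`, "`T(R) = ∑_{d=1}^∞ μ(d) T_d(R)`
with `T_d(R) = #{a, b : … d ∣ a, d ∣ b, R ∣ a − b∛2}`.  Writing `a = da′`, `b = db′` we find that
`T(R) = ∑_d μ(d) S(R′; A′, B′, M′)` (7.3), where `A′ = A/d`, `B′ = B/d`, `M′ = M/d` and
`R′ = R(R, d)⁻¹`."  In root language (`R ↔ (r, k)`, `R ∣ a − b∛2 ↔ r ∣ a − bk`, `R′ ↔ (r/(r,d), k)`):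

* `Tcount r k A B M = #{(a,b) ∈ (A,A+M]×(B,B+M] : (a,b) = 1, r ∣ a − bk}`;
* `card_filter_dvd_dvd_eq` — `T_d`: `#{d ∣ a, d ∣ b, r ∣ a − bk} = #{(a′,b′) ∈ (A/d,(A+M)/d]×(B/d,(B+M)/d] : r/(r,d) ∣ a′ − b′k}`;
* **`Tcount_eq_sum_moebius`** — `T = ∑_{d=1}^{A+M} μ(d) T_d` with `T_d` in the rectangle form (7.3).

## References

* D. R. Heath-Brown, *The largest prime factor of `X³ + 2`*, Proc. London Math. Soc. (3) 82 (2001)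
  554–596, §7 (7.3) p. 25. [`HeathBrown2001LargestPrimeFactorCubic`]

## Mathlib / tree search

Tree: `CubicSieve.sum_divisors_moebius_eq` (`HeathBrownCubicFLRemaindersA`).  Mathlib:
`Nat.Coprime`, `Nat.gcd`, `Nat.div_dvd_iff_dvd_mul`, `Nat.Coprime.dvd_of_dvd_mul_left`,
`Nat.coprime_div_gcd_div_gcd`, `Finset.card_bij`, `Nat.lt_div_iff_mul_lt`, `Nat.le_div_iff_mul_le`.
-/

noncomputable section

open Finset ArithmeticFunction
open scoped ArithmeticFunction.Moebius

namespace Literature.NumberTheory.Sieve.HeathBrown2001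

/-- `T(r, k; A, B, M) = #{A < a ≤ A+M, B < b ≤ B+M : (a, b) = 1, r ∣ a − bk}` (Heath-Brown's `T(R)`).
[cite: HeathBrown2001LargestPrimeFactorCubic, Lemma 11 p. 25] -/
def Tcount (r k A B M : ℕ) : ℕ :=
  #((Ioc A (A + M) ×ˢ Ioc B (B + M)).filter fun ab : ℕ × ℕ =>
    Nat.Coprime ab.1 ab.2 ∧ (r : ℤ) ∣ (ab.1 : ℤ) - ab.2 * k)

/-! ### `r ∣ d·x ↔ r/(r,d) ∣ x` -/

/-- `r ∣ d x ↔ r/(r,d) ∣ x` in `ℤ` (`r ≥ 1`). [folklore] -/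
theorem dvd_mul_iff_div_gcd_dvd {r d : ℕ} (hr : 0 < r) (x : ℤ) :
    ((r : ℤ) ∣ (d : ℤ) * x) ↔ ((r / Nat.gcd r d : ℕ) : ℤ) ∣ x := by
  set g := Nat.gcd r d with hg
  have hg0 : 0 < g := Nat.gcd_pos_of_pos_left _ hr
  obtain ⟨r', hr'⟩ : g ∣ r := Nat.gcd_dvd_left r d
  obtain ⟨d', hd'⟩ : g ∣ d := Nat.gcd_dvd_right r d
  have hcop : Nat.Coprime r' d' := by
    have := Nat.coprime_div_gcd_div_gcd (m := r) (n := d) hg0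
    rwa [← hg, hr', hd', Nat.mul_div_cancel_left _ hg0, Nat.mul_div_cancel_left _ hg0] at this
  have hrg : r / g = r' := by rw [hr', Nat.mul_div_cancel_left _ hg0]
  rw [hrg]
  have hg0' : (g : ℤ) ≠ 0 := by exact_mod_cast hg0.ne'
  constructor
  · rintro ⟨t, ht⟩
    rw [hr', hd'] at ht
    push_cast at ht
    have : (d' : ℤ) * x = r' * t := by
      have := mul_left_cancel₀ hg0' (show (g : ℤ) * (d' * x) = g * (r' * t) by linarith [ht])
      exact this
    have hcopZ : IsCoprime (r' : ℤ) (d' : ℤ) := Nat.isCoprime_iff_coprime.mpr hcop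
    exact hcopZ.dvd_of_dvd_mul_left ⟨t, by linarith [this]⟩
  · rintro ⟨t, ht⟩
    refine ⟨(d' : ℤ) * t, ?_⟩
    rw [hr', hd', ht]; push_cast; ring

/-! ### The reparametrisation `a = da′`, `b = db′` -/

/-- `{A < a ≤ A+M : d ∣ a} ≅ (A/d, (A+M)/d]` by `a = da′` (`d ≥ 1`). [folklore] -/
theorem mem_Ioc_div_iff {d : ℕ} (hd : 0 < d) (A N a' : ℕ) :
    a' ∈ Ioc (A / d) (N / d) ↔ d * a' ∈ Ioc A N := by
  rw [mem_Ioc, mem_Ioc, Nat.div_lt_iff_lt_mul hd, Nat.le_div_iff_mul_le hd, mul_comm]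

/-- **`T_d` as a rectangle count**: for `d ≥ 1`, `r ≥ 1`,
`#{(a,b) ∈ box : d ∣ a, d ∣ b, r ∣ a − bk} = #{(a′,b′) ∈ (A/d,(A+M)/d] × (B/d,(B+M)/d] : r/(r,d) ∣ a′ − b′k}`.
[cite: HeathBrown2001LargestPrimeFactorCubic, §7 (7.3) p. 25] -/
theorem card_filter_dvd_dvd_eq {r d : ℕ} (hr : 0 < r) (hd : 0 < d) (k A B M : ℕ) :
    #((Ioc A (A + M) ×ˢ Ioc B (B + M)).filter fun ab : ℕ × ℕ =>
        d ∣ ab.1 ∧ d ∣ ab.2 ∧ (r : ℤ) ∣ (ab.1 : ℤ) - ab.2 * k) =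
      #((Ioc (A / d) ((A + M) / d) ×ˢ Ioc (B / d) ((B + M) / d)).filter fun ab : ℕ × ℕ =>
        ((r / Nat.gcd r d : ℕ) : ℤ) ∣ (ab.1 : ℤ) - ab.2 * k) := by
  symm
  refine card_bij (fun ab _ => (d * ab.1, d * ab.2)) (fun ab hab => ?_) (fun ab₁ h₁ ab₂ h₂ h => ?_)
    (fun ab hab => ?_)
  · rw [mem_filter, mem_product] at hab ⊢
    obtain ⟨⟨ha, hb⟩, hdvd⟩ := hab
    refine ⟨⟨(mem_Ioc_div_iff hd _ _ _).1 ha, (mem_Ioc_div_iff hd _ _ _).1 hb⟩,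
      dvd_mul_right _ _, dvd_mul_right _ _, ?_⟩
    rw [show ((d * ab.1 : ℕ) : ℤ) - ((d * ab.2 : ℕ) : ℤ) * k = (d : ℤ) * ((ab.1 : ℤ) - ab.2 * k) by push_cast; ring,
      dvd_mul_iff_div_gcd_dvd hr]
    exact hdvd
  · simp only [Prod.mk.injEq] at h
    exact Prod.ext (Nat.eq_of_mul_eq_mul_left hd h.1) (Nat.eq_of_mul_eq_mul_left hd h.2)
  · obtain ⟨a, b⟩ := ab
    rw [mem_filter, mem_product] at hab
    obtain ⟨⟨ha, hb⟩, ⟨a', rfl⟩, ⟨b', rfl⟩, hdvd⟩ := hab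
    refine ⟨(a', b'), ?_, rfl⟩
    rw [mem_filter, mem_product]
    refine ⟨⟨(mem_Ioc_div_iff hd _ _ _).2 ha, (mem_Ioc_div_iff hd _ _ _).2 hb⟩, ?_⟩
    rw [← dvd_mul_iff_div_gcd_dvd hr]
    rw [show (d : ℤ) * ((a' : ℤ) - b' * k) = ((d * a' : ℕ) : ℤ) - ((d * b' : ℕ) : ℤ) * k by push_cast; ring]
    exact hdvd

/-! ### The Möbius decomposition -/

/-- **(7.3)**: `T(r,k; A,B,M) = ∑_{d=1}^{A+M} μ(d) #{(a′,b′) ∈ (A/d,(A+M)/d]×(B/d,(B+M)/d] : r/(r,d) ∣ a′ − b′k}`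
(`r ≥ 1`). [cite: HeathBrown2001LargestPrimeFactorCubic, §7 (7.3) p. 25] -/
theorem Tcount_eq_sum_moebius {r : ℕ} (hr : 0 < r) (k A B M : ℕ) :
    (Tcount r k A B M : ℤ) =
      ∑ d ∈ Icc 1 (A + M), (μ d : ℤ) *
        #((Ioc (A / d) ((A + M) / d) ×ˢ Ioc (B / d) ((B + M) / d)).filter fun ab : ℕ × ℕ =>
          ((r / Nat.gcd r d : ℕ) : ℤ) ∣ (ab.1 : ℤ) - ab.2 * k) := by
  classical
  set box := Ioc A (A + M) ×ˢ Ioc B (B + M) with hbox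
  -- `[(a,b) = 1] = ∑_{d ∣ gcd} μ(d)`
  have hT : (Tcount r k A B M : ℤ) =
      ∑ ab ∈ box.filter (fun ab : ℕ × ℕ => (r : ℤ) ∣ (ab.1 : ℤ) - ab.2 * k),
        ∑ d ∈ (Nat.gcd ab.1 ab.2).divisors, (μ d : ℤ) := by
    rw [Tcount, ← hbox]
    rw [show (box.filter fun ab : ℕ × ℕ => Nat.Coprime ab.1 ab.2 ∧ (r : ℤ) ∣ (ab.1 : ℤ) - ab.2 * k) =
        (box.filter fun ab : ℕ × ℕ => (r : ℤ) ∣ (ab.1 : ℤ) - ab.2 * k).filter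
          (fun ab : ℕ × ℕ => Nat.Coprime ab.1 ab.2) by
      rw [filter_filter]; exact filter_congr fun ab _ => and_comm]
    rw [card_filter]
    push_cast
    refine sum_congr rfl fun ab _ => ?_
    rw [CubicSieve.sum_divisors_moebius_eq]
  rw [hT]
  -- swap: `∑_{ab} ∑_{d ∣ gcd} = ∑_{d ≤ A+M} μ(d) #{ab : d ∣ a, d ∣ b, …}`
  have hswap : ∑ ab ∈ box.filter (fun ab : ℕ × ℕ => (r : ℤ) ∣ (ab.1 : ℤ) - ab.2 * k),
      ∑ d ∈ (Nat.gcd ab.1 ab.2).divisors, (μ d : ℤ) =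
      ∑ ab ∈ box.filter (fun ab : ℕ × ℕ => (r : ℤ) ∣ (ab.1 : ℤ) - ab.2 * k),
        ∑ d ∈ Icc 1 (A + M), if d ∣ ab.1 ∧ d ∣ ab.2 then (μ d : ℤ) else 0 := by
    refine sum_congr rfl fun ab hab => ?_
    rw [mem_filter, hbox, mem_product, mem_Ioc, mem_Ioc] at hab
    obtain ⟨⟨⟨ha1, ha2⟩, hb1, -⟩, -⟩ := hab
    have ha0 : ab.1 ≠ 0 := by omega
    rw [← sum_filter]
    congr 1
    ext d
    rw [Nat.mem_divisors, mem_filter, mem_Icc, Nat.dvd_gcd_iff]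
    constructor
    · rintro ⟨⟨h1, h2⟩, -⟩
      have hd0 : d ≠ 0 := by rintro rfl; exact ha0 (Nat.eq_zero_of_zero_dvd h1)
      exact ⟨⟨Nat.one_le_iff_ne_zero.mpr hd0, (Nat.le_of_dvd (by omega) h1).trans ha2⟩, h1, h2⟩
    · rintro ⟨-, h1, h2⟩
      exact ⟨⟨h1, h2⟩, Nat.gcd_ne_zero_left ha0⟩
  rw [hswap, sum_comm]
  refine sum_congr rfl fun d hd => ?_
  rw [mem_Icc] at hd
  rw [← sum_filter, sum_const, nsmul_eq_mul, mul_comm, filter_filter]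
  congr 2
  rw [← card_filter_dvd_dvd_eq hr (by omega) k A B M, hbox]
  congr 1
  exact filter_congr fun ab _ => by tauto

end Literature.NumberTheory.Sieve.HeathBrown2001
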